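import Summits.CriticalPhenomena.PercolationContinuityZ3.Theorems.PercNearOneGluingNoHeavyRsw3SetToSetTwoPointOneArm
import Summits.CriticalPhenomena.PercolationContinuityZ3.Theorems.PercNearOneGluingNoHeavyRsw3SetToSetAspectDomainOuter
import Summits.CriticalPhenomena.PercolationContinuityZ3.Theorems.PercAnnulusCrossingSetToSetHighDimAspect
import Summits.CriticalPhenomena.PercolationContinuityZ3.Theorems.PercAnnulusCrossingOneArmQuasiMultHighDim
import Summits.CriticalPhenomena.PercolationContinuityZ3.Theorems.PercAnnulusCrossingClusterCountHighDim
import Literature.Barriers.CriticalPhenomena.LaceExpansionEtaZeroXSpaceEventually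
import HarnessLib

/-!
# RSW3 lane (lead, gen 15): (A2)□ FAILS AT EVERY ASPECT IN EVERY DIMENSION `d > 6` under `η = 0` — the (A2)□ row of the
# dimension-sensitivity table closed, by the two-point route; and the table in one declaration

builds on p205010 (kernel theorem, internal audit signed; external expert review pending) — used ONLY through
`Rsw3.setToSetQuasiMultAspectAt_criticalProbI_domain` (the degenerate aspects `s = 1`, `L ≤ s`); the core theorem
`not_setToSetQuasiMultAspectAt_criticalProbI_of_six_lt` (`2 ≤ s < L`) does not use it.

Cell `prim-rsw3` (LANE 3), lead seat, gen 15.  Support file (`--supports stmt-CriticalPhenomena-4575`); no definitions, no named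
facts of its own, no sorries.

THE GAP IT CLOSES.  After gen 14 the (A2)□ column of the lane's table read: at `p_c(ℤ^d)`, (A2)□ (Basu–Sapozhnikov's set-to-set
quasi-multiplicativity in box form at aspect `(s, L)`, `Crossing.SetToSetQuasiMultAspectAt`) is FALSE for `d > 6` under
Aizenman's (t-c) with `η = 0` (`TwoPointBoundedRatio d`) at the printed aspect `(2,4)` and hence at every `(s, L ≤ 4)`
(lead gen 13, V149; p2 gen 17, V169), and at EVERY aspect only for `d > 8` (lead gen 13, V154: three one-arm factors against
`τ ≤ C n^{2-d}`).  The weak end of the chain — large outer aspect `L` in dimensions `7` and `8` — was open.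

THE TWO-POINT ROUTE (p2 gen 17, V170, + the catalogue).  `Rsw3.exists_mul_sq_oneArmProb_le_tau_axis_of_setToSetQuasiMultAspectAt`:
(A2)□ at `p_c(ℤ^d)` at ANY aspect `2 ≤ s < L` gives `c·π_{p_c}(n)² ≤ τ_{p_c}(0, n e₁)` for all `n ≥ 1` (inward arm
continuation).  Under `TwoPointBoundedRatio d`: `π_{p_c}(n) ≥ c₁/n²` (`TwoPointBoundedRatio.oneArmProb_lower`, the EASY half of
`ρ_ex = 1/2`, Heydenreich–van der Hofstad Exercise 11.9 — Kozma–Nachmias's upper bound is NOT needed) and `τ_{p_c}(0, n e₁) ≤ C/n^{d-2}`.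
Hence `c c₁² n^{d-2} ≤ C n⁴` for every `n ≥ 1`, i.e. **`d ≤ 6`** (`le_six_of_sq_oneArmProb_le_tau_axis`, stated for every `p` with
the three bounds as hypotheses).  So:

* **`not_setToSetQuasiMultAspectAt_criticalProbI_of_six_lt : 6 < d → TwoPointBoundedRatio d → 2 ≤ s → s < L → 0 < ϰ →
  ¬ SetToSetQuasiMultAspectAt d (criticalProbI d) s L ϰ`** (p205010 not used);
* **`not_setToSetQuasiMultAspectAt_criticalProbI_of_six_lt_all`** — the same for EVERY `s ≥ 1` and every `L` (the degenerate
  aspects by p2's domain theorem), superseding V154's `8 < d`;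
* **`exists_six_lt_forall_not_setToSetQuasiMultAspectAt_criticalProbI : ∃ d₀ > 6, ∀ d ≥ d₀, ∀ s ≥ 1, ∀ L, ∀ ϰ > 0, ¬ …`** —
  UNCONDITIONAL (the catalogue's hypothesis-free `twoPointBoundedRatio_eventually`);
* **`dimensionSensitivity_of_twoPointBoundedRatio`** — the lane's dimension-sensitivity table as ONE kernel statement for
  `d > 6` under `η = 0`: (A2)□ ✗ at every aspect, one-arm quasi-multiplicativity at all scale pairs ✗ for every constant (V162),
  the critical annulus `Λ(An) ∖ Λ(n)` crossed with probability `→ 1` at every aspect `A ≥ 2` (X_B ✗, V162), the census count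
  `N(n,2n)` exceeds every `K` with probability `→ 1` (tightness ✗, V155) — while one-arm DOUBLING ✓ (V149) and the bounded-ratio
  two-arm probability `α₂(n,2n) → 1` (✓, V155); `dimensionSensitivity_eventually` is its unconditional form for `d ≥ d₀`.

So every LANE-4 / BCKS input the lane typed is now decided above `d_c = 6` at every aspect, given `η = 0`: the inputs that are
lower bounds on connection (doubling, two arms) survive, the inputs that are gluing or upper bounds ((A2)□, all-scales QM, X_B,
tightness) fail; none of the latter admits a dimension-uniform proof, and on `ℤ³` all of them remain OPEN (census: plausible).

References: D. Basu, A. Sapozhnikov, Electron. Commun. Probab. 22 (2017) no. 26, §1 (A2) and §1.2 [BasuSapozhnikov2017ECP];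
M. Aizenman, Nucl. Phys. B 485 (1997) §5 (condition (t-c)) and Thm. 4 [Aizenman1997]; M. Heydenreich, R. van der Hofstad,
*Progress in high-dimensional percolation and random graphs* (2017), Thm. 11.5, Exercise 11.9 [HeydenreichVanDerHofstad2017];
G. Kozma, A. Nachmias, JAMS 24 (2011) Thm. 1 [KozmaNachmias2011]; T. Hara, Ann. Probab. 36 (2008) Thm. 1.1 [Hara2008];
H. Kesten, Comm. Math. Phys. 109 (1987) (planar `τ ≍ π²`) [Kesten1987].
-/

noncomputable section

namespace Summit.CriticalPhenomena.PercolationContinuityZ3.Theorems.Crossing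

open MeasureTheory Filter Topology Literature.Probability.LatticeModels Literature.Probability.Percolation
open Literature.Barriers.CriticalPhenomena SurfaceTension

variable {d : ℕ}

/-! ## The arithmetic core: `c π² ≤ τ` on the axis, `π ≥ c₁/n²`, `τ ≤ C/n^{d-2}` force `d ≤ 6` -/

/-- **The exponent inequality behind the (A2)□ refutation, every `p`, every `d ≥ 1`.**  If for all `n ≥ 1` the one-arm
probability satisfies `c₁/n² ≤ π_p(n)`, the axis two-point function satisfies `τ_p(0, n e₁) ≤ C/n^{d-2}`, and
`c·π_p(n)² ≤ τ_p(0, n e₁)` with `c, c₁ > 0`, then `d ≤ 6`: indeed `c c₁²·n^{d-2} ≤ C·n⁴` for all `n`, impossible for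
`d ≥ 7` (`n^{d-6} ≥ n`).  In exponent language: `2/ρ ≤ 4` and `τ ≍ π²` force `d - 2 + η ≤ 4`, i.e. with `η = 0`, `d ≤ 6`.
[cite: Kesten1987, §1 (scaling relations)] [cite: HeydenreichVanDerHofstad2017, Thm. 11.5 (11.3.2)] -/
theorem le_six_of_sq_oneArmProb_le_tau_axis (hd : 1 ≤ d) (p : unitInterval) {c c₁ C : ℝ} (hc : 0 < c) (hc₁ : 0 < c₁)
    (hπ : ∀ n : ℕ, 1 ≤ n → c₁ / (n : ℝ) ^ 2 ≤ oneArmProb d p n)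
    (hτ : ∀ n : ℕ, 1 ≤ n → tau d p 0 (Pi.single (⟨0, hd⟩ : Fin d) (n : ℤ)) ≤ C / (n : ℝ) ^ (d - 2))
    (h : ∀ n : ℕ, 1 ≤ n → c * oneArmProb d p n ^ 2 ≤ tau d p 0 (Pi.single (⟨0, hd⟩ : Fin d) (n : ℤ))) :
    d ≤ 6 := by
  by_contra hd6
  have hd7 : 7 ≤ d := by omega
  -- for every `n ≥ 1`: `c c₁² n^{d-2} ≤ C n⁴`
  have key : ∀ n : ℕ, 1 ≤ n → c * c₁ ^ 2 * (n : ℝ) ^ (d - 2) ≤ C * (n : ℝ) ^ 4 := by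
    intro n hn
    have hn0 : (0 : ℝ) < n := by exact_mod_cast hn
    have h1 : c * (c₁ / (n : ℝ) ^ 2) ^ 2 ≤ C / (n : ℝ) ^ (d - 2) := by
      have hπ0 : 0 ≤ c₁ / (n : ℝ) ^ 2 := by positivity
      calc c * (c₁ / (n : ℝ) ^ 2) ^ 2 ≤ c * oneArmProb d p n ^ 2 :=
            mul_le_mul_of_nonneg_left (pow_le_pow_left₀ hπ0 (hπ n hn) 2) hc.le
        _ ≤ _ := h n hn
        _ ≤ C / (n : ℝ) ^ (d - 2) := hτ n hn
    have h2 : c * (c₁ / (n : ℝ) ^ 2) ^ 2 = c * c₁ ^ 2 / (n : ℝ) ^ 4 := by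
      rw [div_pow, ← pow_mul]; ring
    rw [h2, div_le_div_iff₀ (by positivity) (by positivity)] at h1
    linarith
  -- choose `n` with `n > C/(c c₁²)` and `n ≥ 1`; then `n^{d-2} ≥ n · n⁴`
  have hcc : 0 < c * c₁ ^ 2 := by positivity
  obtain ⟨n, hn⟩ := exists_nat_gt (max (C / (c * c₁ ^ 2)) 1)
  have hn1' : (1 : ℝ) < n := (le_max_right _ _).trans_lt hn
  have hn1 : 1 ≤ n := by exact_mod_cast hn1'.le
  have hnC : C / (c * c₁ ^ 2) < n := (le_max_left _ _).trans_lt hn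
  have hk := key n hn1
  have hpow : (n : ℝ) * (n : ℝ) ^ 4 ≤ (n : ℝ) ^ (d - 2) := by
    rw [← pow_succ']
    exact pow_le_pow_right₀ hn1'.le (by omega)
  have h3 : c * c₁ ^ 2 * ((n : ℝ) * (n : ℝ) ^ 4) ≤ C * (n : ℝ) ^ 4 :=
    (mul_le_mul_of_nonneg_left hpow hcc.le).trans hk
  have hn4 : (0 : ℝ) < (n : ℝ) ^ 4 := by positivity
  have h4 : c * c₁ ^ 2 * (n : ℝ) ≤ C := by
    have : c * c₁ ^ 2 * (n : ℝ) * (n : ℝ) ^ 4 ≤ C * (n : ℝ) ^ 4 := by rw [mul_assoc]; exact h3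
    exact le_of_mul_le_mul_right this hn4
  rw [div_lt_iff₀ hcc] at hnC
  linarith [mul_comm (c * c₁ ^ 2) (n : ℝ)]

/-- The sup norm of the axis point `n e₁` is `n`. [folklore] -/
theorem norm_zero_sub_single_natCast (hd : 1 ≤ d) (n : ℕ) :
    ‖(0 : Site d) - Pi.single (⟨0, hd⟩ : Fin d) (n : ℤ)‖ = n := by
  rw [zero_sub, norm_neg, Pi.norm_single, Int.norm_eq_abs]
  push_cast
  exact abs_of_nonneg (by positivity)

/-- Under `TwoPointBoundedRatio d` (`d ≥ 2`) the axis two-point function satisfies `τ_{p_c}(0, n e₁) ≤ C/n^{d-2}` for all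
`n ≥ 1`. [cite: Aizenman1997, §5 (condition (t-c) with η = 0)] -/
theorem tau_axis_le_of_twoPointBoundedRatio (hd : 2 ≤ d) (hτ : TwoPointBoundedRatio d) :
    ∃ C : ℝ, 0 < C ∧ ∀ n : ℕ, 1 ≤ n →
      tau d (criticalProbI d) 0 (Pi.single (⟨0, by omega⟩ : Fin d) (n : ℤ)) ≤ C / (n : ℝ) ^ (d - 2) := by
  obtain ⟨C', C, hC', hC'C, hb⟩ := hτ.natPow hd
  refine ⟨C, hC'.trans_le hC'C, fun n hn => ?_⟩
  have hne : (0 : Site d) ≠ Pi.single (⟨0, by omega⟩ : Fin d) (n : ℤ) := by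
    intro h
    have := congrFun h ⟨0, by omega⟩
    rw [Pi.zero_apply, Pi.single_eq_same] at this
    omega
  have h := (hb 0 _ hne).2
  rw [norm_zero_sub_single_natCast (by omega)] at h
  rwa [div_eq_mul_inv]

/-! ## (A2)□ fails at every aspect for every `d > 6` under `η = 0` -/

/-- **(A2)□ FAILS AT `p_c(ℤ^d)` FOR EVERY `d > 6` AT EVERY ASPECT `2 ≤ s < L`, under (t-c) with `η = 0`.**  For `6 < d`,
`TwoPointBoundedRatio d`, `2 ≤ s < L`, `ϰ > 0`: `¬ SetToSetQuasiMultAspectAt d (criticalProbI d) s L ϰ`.  Proof: (A2)□ ⇒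
`c π(n)² ≤ τ(0, n e₁)` (p2 gen 17, inward continuation), `π(n) ≥ c₁/n²` (Exercise 11.9 half of `ρ_ex = 1/2`),
`τ(0, n e₁) ≤ C/n^{d-2}`; `le_six_of_sq_oneArmProb_le_tau_axis`.  Closes `d = 7, 8` at large outer aspect (V154 needed `d > 8`);
`θ(p_c) = 0` is not used. [cite: BasuSapozhnikov2017ECP, §1 assumption (A2) and §1.2 (third bullet)]
[cite: HeydenreichVanDerHofstad2017, Exercise 11.9] -/
theorem not_setToSetQuasiMultAspectAt_criticalProbI_of_six_lt (hd : 6 < d) (hτ : TwoPointBoundedRatio d) {s L : ℕ}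
    (hs : 2 ≤ s) (hsL : s < L) {ϰ : ℝ} (hϰ : 0 < ϰ) : ¬ SetToSetQuasiMultAspectAt d (criticalProbI d) s L ϰ := by
  intro hA2
  obtain ⟨c, hc, hlow⟩ := Rsw3.exists_mul_sq_oneArmProb_le_tau_axis_of_setToSetQuasiMultAspectAt (by omega) hA2 hϰ hs hsL
  obtain ⟨c₁, hc₁, hπ⟩ := hτ.oneArmProb_lower (by omega)
  obtain ⟨C, -, hτC⟩ := tau_axis_le_of_twoPointBoundedRatio (d := d) (by omega) hτ
  have h6 := le_six_of_sq_oneArmProb_le_tau_axis (by omega) (criticalProbI d) hc hc₁ hπ hτC hlow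
  omega

/-- **(A2)□ FAILS AT `p_c(ℤ^d)` FOR EVERY `d > 6` AT EVERY ASPECT `(s, L)` WITH `s ≥ 1`, under (t-c) with `η = 0`** — the
previous theorem inside the domain `2 ≤ s < L`, and p2 gen 17's domain theorem
(`Rsw3.setToSetQuasiMultAspectAt_criticalProbI_domain`: outside it the Prop is false at `p_c` for `s ≥ 1`, via `θ(p_c) = 0`)
outside.  Supersedes `not_setToSetQuasiMultAspectAt_criticalProbI_of_twoPointBoundedRatio` (`8 < d`, V154).
[cite: BasuSapozhnikov2017ECP, §1 assumption (A2)] [cite: Aizenman1997, §5 (condition (t-c) with η = 0)] -/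
theorem not_setToSetQuasiMultAspectAt_criticalProbI_of_six_lt_all (hd : 6 < d) (hτ : TwoPointBoundedRatio d) {s : ℕ}
    (hs : 1 ≤ s) (L : ℕ) {ϰ : ℝ} (hϰ : 0 < ϰ) : ¬ SetToSetQuasiMultAspectAt d (criticalProbI d) s L ϰ := by
  intro hA2
  obtain ⟨hs2, hsL⟩ := Rsw3.setToSetQuasiMultAspectAt_criticalProbI_domain (by omega) hs hϰ hA2
  exact not_setToSetQuasiMultAspectAt_criticalProbI_of_six_lt hd hτ hs2 hsL hϰ hA2

/-- The same granted the named fact `Hara2008_etaZeroXSpace`, for `d ≥ 11` (as V154, now by the two-point route).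
[cite: Hara2008, Thm. 1.1] [cite: BasuSapozhnikov2017ECP, §1 assumption (A2)] -/
theorem not_setToSetQuasiMultAspectAt_criticalProbI_of_hara' (hH : Hara2008_etaZeroXSpace) (hd : 11 ≤ d) {s L : ℕ}
    (hs : 2 ≤ s) (hsL : s < L) {ϰ : ℝ} (hϰ : 0 < ϰ) : ¬ SetToSetQuasiMultAspectAt d (criticalProbI d) s L ϰ :=
  not_setToSetQuasiMultAspectAt_criticalProbI_of_six_lt (by omega) (hH.twoPointBoundedRatio hd) hs hsL hϰ

/-- **UNCONDITIONAL: there is `d₀ > 6` such that for every `d ≥ d₀`, (A2)□ fails at `p_c(ℤ^d)` at every aspect `(s, L)`,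
`s ≥ 1`, for every constant** (the catalogue's hypothesis-free `twoPointBoundedRatio_eventually`, Hara–Slade + Hara, kernel).
[cite: Hara2008, Thm. 1.1] [cite: BasuSapozhnikov2017ECP, §1.2 (third bullet)] -/
theorem exists_six_lt_forall_not_setToSetQuasiMultAspectAt_criticalProbI :
    ∃ d₀ : ℕ, 6 < d₀ ∧ ∀ d : ℕ, d₀ ≤ d → ∀ s : ℕ, 1 ≤ s → ∀ L : ℕ, ∀ ϰ : ℝ, 0 < ϰ →
      ¬ SetToSetQuasiMultAspectAt d (criticalProbI d) s L ϰ := by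
  obtain ⟨d₀, h6, h⟩ := twoPointBoundedRatio_eventually
  exact ⟨d₀, h6, fun d hd s hs L ϰ hϰ =>
    not_setToSetQuasiMultAspectAt_criticalProbI_of_six_lt_all (h6.trans_le hd) (h d hd) hs L hϰ⟩

/-! ## The dimension-sensitivity table in one declaration -/

/-- **THE LANE'S DIMENSION-SENSITIVITY TABLE, KERNEL FORM** (`d > 6`, (t-c) with `η = 0`).  At `p_c(ℤ^d)`:
(1) (A2)□ fails at every aspect `(s, L)`, `s ≥ 1`, for every `ϰ > 0` (this file);
(2) one-arm quasi-multiplicativity at all scale pairs fails for every `c > 0` (lead gen 14, V162);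
(3) the annulus `Λ(A n) ∖ Λ(n)` is crossed with probability `→ 1` at every aspect `A ≥ 2` — the blocking postulate X_B fails
    at every aspect (V162);
(4) the free-box cluster count `N(n,2n)` exceeds every level `K` with probability `→ 1` — tightness fails (lead gen 13, V155);
while (5) one-arm DOUBLING holds with some constant (lead gen 13, V149) and (6) the bounded-ratio two-arm probability
`α₂(n,2n) → 1` (V155).  On `ℤ³` every one of (1)–(4) is OPEN in the kernel and numerically plausible (lane census), so none of
them admits a dimension-uniform proof. [cite: Aizenman1997, Thm. 4] [cite: KozmaNachmias2011, Thm. 1]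
[cite: BasuSapozhnikov2017ECP, §1.2 (third bullet)] -/
theorem dimensionSensitivity_of_twoPointBoundedRatio [NeZero d] (hd : 6 < d) (hτ : TwoPointBoundedRatio d) :
    (∀ s : ℕ, 1 ≤ s → ∀ L : ℕ, ∀ ϰ : ℝ, 0 < ϰ → ¬ SetToSetQuasiMultAspectAt d (criticalProbI d) s L ϰ) ∧
    (∀ c : ℝ, 0 < c → ¬ OneArmQuasiMultAt d (criticalProbI d) c) ∧
    (∀ A : ℕ, 2 ≤ A →
      Tendsto (fun n => (bondPercolation (zdGraph d) (criticalProbI d)).real (boxCrossing d n (A * n))) atTop (𝓝 1)) ∧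
    (∀ K : ℝ, Tendsto (fun n : ℕ => (bondPercolation (zdGraph d) (criticalProbI d)).real
        {ω | ENNReal.ofReal K ≤ (annulusClusterCount d n (2 * n) ω : ENNReal)}) atTop (𝓝 1)) ∧
    (∃ c : ℝ, 0 < c ∧ OneArmDoublingAt d (criticalProbI d) c) ∧
    Tendsto (fun n : ℕ => annulusTwoArmProb d (criticalProbI d) n (2 * n)) atTop (𝓝 1) :=
  ⟨fun _ hs L _ hϰ => not_setToSetQuasiMultAspectAt_criticalProbI_of_six_lt_all hd hτ hs L hϰ,
    fun _ hc => not_oneArmQuasiMultAt_criticalProbI_of_twoPointBoundedRatio hd hτ hc,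
    fun _ hA => tendsto_real_boxCrossing_mul_criticalProbI_of_twoPointBoundedRatio hd hτ hA,
    fun K => tendsto_real_le_annulusClusterCount_of_twoPointBoundedRatio hd hτ K,
    exists_oneArmDoublingAt_criticalProbI_of_rhoExHalf (hτ.rhoExHalf hd),
    tendsto_annulusTwoArmProb_of_twoPointBoundedRatio hd hτ⟩

/-- **The table for all sufficiently large `d`, UNCONDITIONAL** (`twoPointBoundedRatio_eventually`).
[cite: Hara2008, Thm. 1.1] [cite: Aizenman1997, Thm. 4] [cite: KozmaNachmias2011, Thm. 1] -/
theorem dimensionSensitivity_eventually :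
    ∃ d₀ : ℕ, 6 < d₀ ∧ ∀ d : ℕ, d₀ ≤ d → ∀ [NeZero d],
      (∀ s : ℕ, 1 ≤ s → ∀ L : ℕ, ∀ ϰ : ℝ, 0 < ϰ → ¬ SetToSetQuasiMultAspectAt d (criticalProbI d) s L ϰ) ∧
      (∀ c : ℝ, 0 < c → ¬ OneArmQuasiMultAt d (criticalProbI d) c) ∧
      (∀ A : ℕ, 2 ≤ A →
        Tendsto (fun n => (bondPercolation (zdGraph d) (criticalProbI d)).real (boxCrossing d n (A * n))) atTop (𝓝 1)) ∧
      (∀ K : ℝ, Tendsto (fun n : ℕ => (bondPercolation (zdGraph d) (criticalProbI d)).real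
          {ω | ENNReal.ofReal K ≤ (annulusClusterCount d n (2 * n) ω : ENNReal)}) atTop (𝓝 1)) ∧
      (∃ c : ℝ, 0 < c ∧ OneArmDoublingAt d (criticalProbI d) c) ∧
      Tendsto (fun n : ℕ => annulusTwoArmProb d (criticalProbI d) n (2 * n)) atTop (𝓝 1) := by
  obtain ⟨d₀, h6, h⟩ := twoPointBoundedRatio_eventually
  exact ⟨d₀, h6, fun d hd _ => dimensionSensitivity_of_twoPointBoundedRatio (h6.trans_le hd) (h d hd)⟩

end Summit.CriticalPhenomena.PercolationContinuityZ3.Theorems.Crossing
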